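import Summits.QuantumFields.YangMills.Theorems.BalabanUVNodesPortHRecordJoinRows
import Summits.QuantumFields.YangMills.Theorems.BalabanUVNodesPortHRecordJoinSwap
import Summits.QuantumFields.YangMills.Theorems.BalabanUVNodesPortHIotaRowAtL
import Summits.QuantumFields.YangMills.Theorems.BalabanUVNodesPortHDecayOfRowsTrace
import Summits.QuantumFields.YangMills.Theorems.BalabanUVNodesPortU8TokP9L4Bridge
import Summits.QuantumFields.YangMills.Theorems.BalabanUVNodesPortHRecordRowG

/-!
# PORT helper (PT-H ∕ K0ᴬ JOIN lineage; ORDER O-3 (b)) — THE RECORD JOIN: the trace road (✓p801140 `PortH.decay510_plimOf_of_rows_trace`) AT THE RECORD's NAMES READ AT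
# DEF-1's DRESSED CHART `recordEmbL`, run level = 2″'s antecedent `RecordPlimDecayOnRunsAx` BY NAME, and the TEXT-LEVEL JOIN
# `joinGoalL_of_texts_final : (∀ F, Sig8LR4 F) → (∀ F, Sig7L9 F) → ∀ F, JoinGoalL F` over the LOCAL verbatim signed texts (route file NOT imported — docket O-8)

AUTHORSHIP ∕ CREDIT.  The mathematics and the Lean text below are ◇ LENS-1's (planner seat `ymgap-nodeO-lens-1` g4–g5), HOME file of record
`pub/ym-nodeO-ideate/nodeO-cover/LENS-1-Slot8RecordJoin-v5.2.lean` (sha16 01e44366c253a20c · 1 783 l. · 91 thm · 19 def; farm rc 0 · 0 warn · 0 sorry; §-numbers below are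
that file's), landed for the tree by porter PTC-1 g3 (`ymgap-nodeO-port-PTC-1`) under port-lead ORDER O-3 (b) (nodeO STATUS 2026-08-31T01:44:50Z ∕ 02:17:04Z ∕ 02:23:59Z),
keyed `--supports stmt-QuantumFields-27238 --as helper` (K0ᴬ `Record13SepCoPHInhabitedAx`; no `--workitem`, R615).  Deviations from the HOME bytes: the namespace
(`…Theorems.PortHRecordJoin`), the split into ≤ 400-line files (`…PortHRecordJoinDefs` ∕ `…Rows` ∕ `…Swap` ∕ `…Join` + `…PortHIotaRowAtL`), tree receipts cited BY NAME
instead of displayed hypotheses, the family binder `F` made explicit on `Sig8LR4 ∕ Sig7L9 ∕ JoinGoalL`, and NO import of the route file `Theses.BalabanUVNodes` anywhere (port-lead docket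
O-8: the JOIN is keyed to LOCAL verbatim copies of the two signed texts, so a re-key of a route decl cannot break it).  [I] = [Balaban1987RG1], [15] = [Balaban1985Variational].

THIS FILE (JOIN §15 + §16∕§18∕§19-end):
* §15 ★★★ `recordDecay_of_trace_L` — MEMBER LEVEL, ONE CHART, NO SLOT HYPOTHESIS: ⁸'s consequent AS SIGNED (rooted `recordEmbJ`) ∧ the LOCAL swap row at a chart
  parameter `ιL` ∧ ⁷‴'s (C1) `∀ a, Response9DAtL …` BY NAME ∧ (C2a′)(C2b′) at `ιL` ∧ the (L+) face ∧ RowG at the names ∧ the (1.21) letter ⟹ `Decay510 (recordPlimAx F a₀ ε₂₉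
  k v 0 1) (16·E₀·C₉²·e^{δ₁ Mg c₁}·K₀·K₁) (delta1 δ₀ κ Mg)` (the tree's trace road instantiated at `fam := recordTermsAx`, `θ.ρ8`, `θ.bV`, the two-block record names, members
  `recordK₀ + n`, ONE `R := flipL F θ a⋆ …`, colour-indexed responses `recordGkL … a`; `FormatPlusG` moved to `ιL` by `formatPlusG_chartSwap`); ★★ `recordPlimDecayOnRunsAx_of_trace_L`
  (RUN LEVEL along in-interval `RGEqH` runs); ★★★★★★ `recordPlimDecayOnRunsAx_at_recordEmbL_of_trace` — the L-ROAD JOIN OF RECORD at `ιL k n := recordEmbL F θ k (recordK₀ F Mc k + n)`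
  with the swap row DISCHARGED (`swapRowAtL_of_p9RegAt`, `…PortHRecordJoinSwap`): displayed rows EXACTLY ⁸'s consequent AS SIGNED · TokP9-reg on the runs' tori (`P9RegAt`) ·
  ⁷‴'s (C1) BY NAME · (E1′) `IotaRowAtL` · (E4a) `ResponseRowAtL` · RowG at the names · the (1.21) letter on runs ⟹ `RecordPlimDecayOnRunsAx F a₀ ε₂₉ γ₀ C (delta1 δ₀ κ Mg)`.
* §16∕§18∕§19 `responseRowAtL_of_p9RegAt` ((E4a), ★ PTB-1 ✓p801893), `iotaRowAtL_of_p9RegAt` ((E1′), ◇ lens-1 via `…PortHIotaRowAtL`), ★★★★★★★ `joinGoalL_of_texts_final (h8 : ∀ F, Sig8LR4 F)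
  (h7 : ∀ F, Sig7L9 F) (F) : JoinGoalL F` (+ primed `∀ F` form) — lens-1's `joinGoalL_of_texts` with the bridge ∕ RowG ∕ (E1′) ∕
  (E4a) hypotheses replaced by the tree theorems; `h8 : ∀ F, Sig8LR4 F`, `h7 : ∀ F, Sig7L9 F` = the LOCAL verbatim texts of `…PortHRecordJoinDefs` (route file NOT imported, O-8).

HONEST FRAMING.  Bookkeeping ∕ calculus ∕ generic implications over DISPLAYED rows; every displayed row of the JOIN is the consequent of an OPEN signed statement item
(27930 ⁸ `PortRecordRepresentationS1` 12934e3fd231d69a; 27931 ⁷‴ `PortPieceLocalityU8` v9-L ce176c419bf63055) or a tree receipt; TokP9-reg ([15] Thm 1 + Prop. 9 AT THE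
RECORD) is the texts' own antecedent and is NOT proved; nothing of [I] (Thm 1, (1.19)–(1.22), (4.33)–(4.37), (5.10)) or [15] (Thm 1, Prop. 9, (190)) is asserted, ported,
discharged or refuted; K-Ax 27238∕27239∕27247 OPEN; K0⁷∕K0ᴬ OPEN; NODE O 0∕1; COUNT 8∕28 · K 1∕4 UNMOVED; ONE finite `𝕋⁴_{L^K}` at fixed ε — NOT continuum ∕ OS ∕ Clay;
**the Yang–Mills mass gap (Clay) is NOT proved by any of this.**  No `sorry`, no `instance`, no `notation`; standard axioms.
-/

noncomputable section

open scoped BigOperators Matrix.Norms.L2Operator Topology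
open Set Filter

namespace Summit.QuantumFields.YangMills.Theorems.PortHRecordJoin

open Summit.QuantumFields.YangMills.Theorems.K0RecordFormatNames
open Summit.QuantumFields.YangMills.Theorems
open Literature.MathematicalPhysics.QuantumFieldTheory.Balaban1983to89
open Literature.MathematicalPhysics.QuantumFieldTheory.Balaban1983to89.Node00
open Literature.MathematicalPhysics.QuantumFieldTheory.Balaban1983to89.T4Continuum (T4Family)
open NormedSpace (exp)

variable {F : T4Family}

/-! ## §15  (v4.1, g5) T-3″ DISCHARGED BY NAME — THE TRACE ROAD IS IN THE TREE (porter PTC-1 g2, ✓p801140 `…PortHDecayOfRowsTrace`, `PortH.decay510_plimOf_of_rows_trace`: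
rows ∀ colours, NO RowS′ ∕ `aStar`, explicit constant `16·E₀·C₉²·e^{δ₁ Mg c₁}·K₀·K₁`).  The candidate text `SlotT3pp` (§10) is no longer a hypothesis of the L-road: the member ∕ run ∕
dressed-chart theorems below call the tree theorem directly (one `R := flipL F θ a⋆ …` — every non-`Gk` field colour-blind — and the colour-indexed responses `Gc n a := recordGkL … a`). -/

/-- ★★★ **MEMBER LEVEL, ONE CHART, NO SLOT HYPOTHESIS** (trace road BY NAME): ⁸'s consequent AS SIGNED (rooted) ∧ the LOCAL swap row at `ιL` ∧ ⁷‴'s (C1) `∀ a, Response9DAtL …` BY NAME ∧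
(C2a′)(C2b′) at `ιL` ∧ the (L+) face ∧ RowG at the names ∧ the (1.21) letter ⟹ `Decay510 (recordPlimAx F a₀ ε₂₉ k v 0 1) (16·E₀·C₉²·e^{δ₁ Mg c₁}·K₀·K₁) (delta1 δ₀ κ Mg)`.
[cite: Balaban1987RG1, (5.10) p.293, (1.19)–(1.21) pp.263–264, (4.35)–(4.37) pp.290–291, (1.10) p.262; Balaban1985Variational, Prop. 9 p.309, (21) p.281] -/
theorem recordDecay_of_trace_L {E₀ κ C₉ δ₀ Mg c₁ K₀' K₁ : ℝ}
    (hE₀ : 0 ≤ E₀) (hκ : 0 < κ) (hC₉ : 0 ≤ C₉) (hδ₀ : 0 < δ₀) (hMg : 0 < Mg) (hK₀' : 0 ≤ K₀') :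
    ∀ (F : T4Family) (a₀ ε₂₉ α₀ α₁ : ℝ), 0 < α₀ → 0 < α₁ → ∀ (Mc k : ℕ) (v : Fin (k + 1) → ℝ),
      letI θ := thetaFill F a₀ ε₂₉; letI := θ.instVβ₁; letI := θ.instVβ₂; letI := θ.instιβ
      ∀ ιL : (n : ℕ) → recordW F a₀ ε₂₉ k (recordK₀ F Mc k + n) → (Fin (recordChartDimJ F (recordK₀ F Mc k + n)) → ℂ),
      B12FormatPlus.FormatPlusG (fun n => recordDomSys F Mc k (recordK₀ F Mc k + n)) (fun n => recordBondCount F (recordK₀ F Mc k + n))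
          (fun n => recordAct F (recordK₀ F Mc k + n)) (fun n => recordUc F Mc k α₀ α₁ (recordK₀ F Mc k + n))
          (fun n => recordCoords F Mc k (recordK₀ F Mc k + n)) (fun n => recordChartDimJ F (recordK₀ F Mc k + n))
          (fun n => recordChartJ F Mc k (recordK₀ F Mc k + n)) (fun n => recordΦfAx F a₀ ε₂₉ k v (recordK₀ F Mc k + n))
          (fun n => recordEmbJ F θ k (recordK₀ F Mc k + n)) (fun n => recordWrapCtr F Mc k (recordK₀ F Mc k + n))
          (fun n => recordDomEmbCtr F Mc k (recordK₀ F Mc k + n)) (fun n _ => recordCoordProjCtr F (recordK₀ F Mc k + n)) E₀ κ →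
      (∀ n, ∀ᶠ B in 𝓝 (0 : recordW F a₀ ε₂₉ k (recordK₀ F Mc k + n)), ∀ X : (recordDomSys F Mc k (recordK₀ F Mc k + n)).Dom,
          ∃ g : recordGaugeGrp F (recordK₀ F Mc k + n), ∀ i ∈ recordCoords F Mc k (recordK₀ F Mc k + n) X,
            recordChartJ F Mc k (recordK₀ F Mc k + n) X (ιL n B) i =
              recordAct F (recordK₀ F Mc k + n) g (recordChartJ F Mc k (recordK₀ F Mc k + n) X (recordEmbJ F θ k (recordK₀ F Mc k + n) B)) i) →
      (∀ a : θ.ιβ, Response9DAtL F θ a Mc k (recordK₀ F Mc k) (min (1 / 4 : ℝ) (min α₁ (α₀ / 36))) C₉ δ₀) →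
      (∀ n : ℕ, ContDiffAt ℝ 2 (ιL n) 0 ∧ ιL n 0 = 0) →
      (∀ (n : ℕ) (a : θ.ιβ) (l : RespLabel F k (recordK₀ F Mc k + n)),
          recordGkL F θ k (recordK₀ F Mc k + n) a l = fun i => fderiv ℝ (ιL n) 0 (Pi.single l.1 (Pi.single l.2 (θ.bV a))) i) →
      ((∀ n, B12Decay510.GeomLeaf (recordSiteGeom F Mc k (recordK₀ F Mc k + n)) (recordRho F k (recordK₀ F Mc k + n)) Mg c₁ ∧
            B12Decay510.CubeSumLeaf (recordSiteGeom F Mc k (recordK₀ F Mc k + n)) (δ₀ / 2) K₁ ∧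
            B12Decay510.TreeLeaf (recordCc F Mc k (recordK₀ F Mc k + n)) (κ / 2) K₀') ∧
        ∀ (μ ν : Fin 4) (z : Fin 4 → ℤ), ∀ᶠ n in atTop,
          recordRho F k (recordK₀ F Mc k + n) (recordE F k (recordK₀ F Mc k + n) μ 0) (recordE F k (recordK₀ F Mc k + n) ν z) = B12Sec2to5.l1 z) →
      PolLimitExists F (k + 1) (fun K => recordTermsAx F a₀ ε₂₉ k v K) θ.ρ8 θ.bV →
      B12Sec2to5.Decay510 (recordPlimAx F a₀ ε₂₉ k v 0 1)
        (16 * E₀ * C₉ ^ 2 * Real.exp (B12Decay510.delta1 δ₀ κ Mg * Mg * c₁) * K₀' * K₁) (B12Decay510.delta1 δ₀ κ Mg) := by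
  classical
  intro F a₀ ε₂₉ α₀ α₁ hα₀ hα₁ Mc k v ιL hFmt hsw hResp hL hGk hG h121
  letI θ := thetaFill F a₀ ε₂₉; letI := θ.instVβ₁; letI := θ.instVβ₂; letI := θ.instιβ
  have hFmtL := formatPlusG_chartSwap hFmt hsw
  have hRG := rowG_flipL θ (recordAStar F a₀ ε₂₉) hG
  exact PortH.decay510_plimOf_of_rows_trace F (recordTermsAx F a₀ ε₂₉) θ.ρ8 θ.bV k v
    (fun n => recordUc F Mc k α₀ α₁ (recordK₀ F Mc k + n)) (fun n => recordCoords F Mc k (recordK₀ F Mc k + n))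
    (fun n => recordChartJ F Mc k (recordK₀ F Mc k + n))
    (fun n X => recordDom44J F Mc k (recordK₀ F Mc k + n) X (min (1 / 4 : ℝ) (min α₁ (α₀ / 36))))
    (fun n => recordAct F (recordK₀ F Mc k + n)) (fun n => recordToG F (recordK₀ F Mc k + n)) (fun n => recordAdJ F (recordK₀ F Mc k + n))
    (flipL F θ (recordAStar F a₀ ε₂₉) Mc k (recordK₀ F Mc k)) (fun n => recordK₀ F Mc k + n)
    (fun n a (y : RespLabel F k (recordK₀ F Mc k + n)) => recordGkL F θ k (recordK₀ F Mc k + n) a y) ιL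
    hE₀ hκ.le hC₉ hδ₀.le hMg hK₀' hFmtL (K0PortChart44DAtRecord.chart44DJ_record F Mc k hα₀ hα₁)
    (chartEquivariant_members Mc k (recordK₀ F Mc k)) (noInvariantCovector_members (recordK₀ F Mc k))
    (chart_cut_members_L θ (recordAStar F a₀ ε₂₉) Mc k (recordK₀ F Mc k) _)
    (fun n a X y => (response9D_flipL θ a Mc k (recordK₀ F Mc k) (hResp a)).2.2.1 n X y)
    (fun n => (hRG.1 n).1) (fun n => (hRG.1 n).2.1) (fun n => (hRG.1 n).2.2) hRG.2
    (fun n => ⟨(hL n).2, (hL n).1, fun a μ z => hGk n a _⟩)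
    (limit121_members (recordTermsAx F a₀ ε₂₉) θ.ρ8 θ.bV k v (recordK₀ F Mc k) h121)

/-- ★★ **RUN LEVEL, ONE CHART, NO SLOT HYPOTHESIS** (trace road BY NAME): as `recordPlimDecayOnRunsAx_of_rowsL` with `SlotT3pp` GONE and the constant explicit.
[cite: Balaban1987RG1, (0.20) p.256, (1.19)–(1.22) pp.263–264, (4.35)–(4.37) p.290, (5.10) p.293; Balaban1985Variational, Prop. 9 p.309, (21) p.281] -/
theorem recordPlimDecayOnRunsAx_of_trace_L {E₀ κ C₉ δ₀ Mg c₁ K₀' K₁ : ℝ}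
    (hE₀ : 0 ≤ E₀) (hκ : 0 < κ) (hC₉ : 0 ≤ C₉) (hδ₀ : 0 < δ₀) (hMg : 0 < Mg) (hK₀' : 0 ≤ K₀') :
    ∀ (F : T4Family) (a₀ ε₂₉ γ₀ α₀ α₁ : ℝ), 0 < α₀ → 0 < α₁ → ∀ (Mc : ℕ),
      letI θ := thetaFill F a₀ ε₂₉; letI := θ.instVβ₁; letI := θ.instVβ₂; letI := θ.instιβ
      ∀ ιL : (k n : ℕ) → recordW F a₀ ε₂₉ k (recordK₀ F Mc k + n) → (Fin (recordChartDimJ F (recordK₀ F Mc k + n)) → ℂ),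
      (∀ (k : ℕ) (g : ℕ → ℝ), FlowStep.RGEqH k (betaOfRecord₁₃Ax F 2 (thetaFill F a₀ ε₂₉)) g → Step.InInterval γ₀ k g →
        B12FormatPlus.FormatPlusG (fun n => recordDomSys F Mc k (recordK₀ F Mc k + n)) (fun n => recordBondCount F (recordK₀ F Mc k + n))
          (fun n => recordAct F (recordK₀ F Mc k + n)) (fun n => recordUc F Mc k α₀ α₁ (recordK₀ F Mc k + n))
          (fun n => recordCoords F Mc k (recordK₀ F Mc k + n)) (fun n => recordChartDimJ F (recordK₀ F Mc k + n))
          (fun n => recordChartJ F Mc k (recordK₀ F Mc k + n)) (fun n => recordΦfAx F a₀ ε₂₉ k (FlowStep.prefixOf g k) (recordK₀ F Mc k + n))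
          (fun n => recordEmbJ F θ k (recordK₀ F Mc k + n)) (fun n => recordWrapCtr F Mc k (recordK₀ F Mc k + n))
          (fun n => recordDomEmbCtr F Mc k (recordK₀ F Mc k + n)) (fun n _ => recordCoordProjCtr F (recordK₀ F Mc k + n)) E₀ κ) →
      (∀ (k n : ℕ), ∀ᶠ B in 𝓝 (0 : recordW F a₀ ε₂₉ k (recordK₀ F Mc k + n)), ∀ X : (recordDomSys F Mc k (recordK₀ F Mc k + n)).Dom,
          ∃ g : recordGaugeGrp F (recordK₀ F Mc k + n), ∀ i ∈ recordCoords F Mc k (recordK₀ F Mc k + n) X,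
            recordChartJ F Mc k (recordK₀ F Mc k + n) X (ιL k n B) i =
              recordAct F (recordK₀ F Mc k + n) g (recordChartJ F Mc k (recordK₀ F Mc k + n) X (recordEmbJ F θ k (recordK₀ F Mc k + n) B)) i) →
      (∀ k : ℕ, (∀ a : θ.ιβ, Response9DAtL F θ a Mc k (recordK₀ F Mc k) (min (1 / 4 : ℝ) (min α₁ (α₀ / 36))) C₉ δ₀) ∧
          (∀ n : ℕ, ContDiffAt ℝ 2 (ιL k n) 0 ∧ ιL k n 0 = 0) ∧
          ∀ (n : ℕ) (a : θ.ιβ) (l : RespLabel F k (recordK₀ F Mc k + n)),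
            recordGkL F θ k (recordK₀ F Mc k + n) a l = fun i => fderiv ℝ (ιL k n) 0 (Pi.single l.1 (Pi.single l.2 (θ.bV a))) i) →
      (∀ k : ℕ, (∀ n, B12Decay510.GeomLeaf (recordSiteGeom F Mc k (recordK₀ F Mc k + n)) (recordRho F k (recordK₀ F Mc k + n)) Mg c₁ ∧
            B12Decay510.CubeSumLeaf (recordSiteGeom F Mc k (recordK₀ F Mc k + n)) (δ₀ / 2) K₁ ∧
            B12Decay510.TreeLeaf (recordCc F Mc k (recordK₀ F Mc k + n)) (κ / 2) K₀') ∧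
        ∀ (μ ν : Fin 4) (z : Fin 4 → ℤ), ∀ᶠ n in atTop,
          recordRho F k (recordK₀ F Mc k + n) (recordE F k (recordK₀ F Mc k + n) μ 0) (recordE F k (recordK₀ F Mc k + n) ν z) = B12Sec2to5.l1 z) →
      RecordPolLimitOnRunsAx F a₀ ε₂₉ γ₀ →
      RecordPlimDecayOnRunsAx F a₀ ε₂₉ γ₀
        (16 * E₀ * C₉ ^ 2 * Real.exp (B12Decay510.delta1 δ₀ κ Mg * Mg * c₁) * K₀' * K₁) (B12Decay510.delta1 δ₀ κ Mg) := by
  intro F a₀ ε₂₉ γ₀ α₀ α₁ hα₀ hα₁ Mc ιL h8 hsw h7 hG h121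
  unfold RecordPlimDecayOnRunsAx
  refine ⟨B12Decay510.delta1_pos hδ₀ hκ hMg, fun n gs hrg hin k hk => ?_⟩
  have hrgk : FlowStep.RGEqH k (betaOfRecord₁₃Ax F 2 (thetaFill F a₀ ε₂₉)) gs := fun i hi => hrg i (lt_of_lt_of_le hi hk)
  have hink : Step.InInterval γ₀ k gs := fun i hi => hin i (hi.trans hk)
  exact recordDecay_of_trace_L hE₀ hκ hC₉ hδ₀ hMg hK₀' F a₀ ε₂₉ α₀ α₁ hα₀ hα₁ Mc k (FlowStep.prefixOf gs k) (ιL k) (h8 k gs hrgk hink)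
    (hsw k) (h7 k).1 (h7 k).2.1 (h7 k).2.2 (hG k) (h121 n gs hrg hin k hk)

/-- ★★★★★★ **THE L-ROAD JOIN OF RECORD (v4.1)** — RUN LEVEL AT THE DRESSED CHART `recordEmbL`, SWAP ROW DERIVED (§14), SLOT DISCHARGED BY NAME (trace road, §15): the displayed rows are EXACTLY
⁸'s consequent AS SIGNED (27930, OPEN) · TokP9-reg on the runs' tori (⁸'s ∕ ⁷‴'s own antecedent) · ⁷‴'s (C1) `∀ a, Response9DAtL …` BY NAME (27931 v9-L, OPEN) · (E1′) `IotaRowAtL` (porter) ·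
(E4a) `ResponseRowAtL` (porter PTB-1) · RowG at the names (HOME GroupG v1.3 ∕ PTC-1 INTENT-7) · the (1.21) letter on runs (`RecordPolLimitOnRunsAx`, ⁸'s antecedent ∕ Lemmas5) ⟹
**`RecordPlimDecayOnRunsAx F a₀ ε₂₉ γ₀ (16·E₀·C₉²·e^{δ₁ Mg c₁}·K₀·K₁) (delta1 δ₀ κ Mg)`** — 2″'s antecedent BY NAME.  HONEST: conditional on two OPEN signed texts and two porter rows;
nothing of Bałaban discharged; K0⁷∕K0ᴬ OPEN; NODE O 0∕1. [cite: Balaban1987RG1, Thm 1 p.259, (0.20) p.256, (1.19)–(1.22) pp.263–264, (2.3) p.265, (4.2) p.281, (4.35)–(4.37) p.290,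
(5.10) p.293; Balaban1985Variational, Prop. 9 p.309, (21) p.281] -/
theorem recordPlimDecayOnRunsAx_at_recordEmbL_of_trace {E₀ κ C₉ δ₀ Mg c₁ K₀' K₁ : ℝ}
    (hE₀ : 0 ≤ E₀) (hκ : 0 < κ) (hC₉ : 0 ≤ C₉) (hδ₀ : 0 < δ₀) (hMg : 0 < Mg) (hK₀' : 0 ≤ K₀') :
    ∀ (F : T4Family) (a₀ ε₂₉ γ₀ α₀ α₁ : ℝ), 0 < α₀ → 0 < α₁ → ∀ (Mc : ℕ),
      letI θ := thetaFill F a₀ ε₂₉; letI := θ.instVβ₁; letI := θ.instVβ₂; letI := θ.instιβ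
      (∀ (k : ℕ) (g : ℕ → ℝ), FlowStep.RGEqH k (betaOfRecord₁₃Ax F 2 (thetaFill F a₀ ε₂₉)) g → Step.InInterval γ₀ k g →
        B12FormatPlus.FormatPlusG (fun n => recordDomSys F Mc k (recordK₀ F Mc k + n)) (fun n => recordBondCount F (recordK₀ F Mc k + n))
          (fun n => recordAct F (recordK₀ F Mc k + n)) (fun n => recordUc F Mc k α₀ α₁ (recordK₀ F Mc k + n))
          (fun n => recordCoords F Mc k (recordK₀ F Mc k + n)) (fun n => recordChartDimJ F (recordK₀ F Mc k + n))
          (fun n => recordChartJ F Mc k (recordK₀ F Mc k + n)) (fun n => recordΦfAx F a₀ ε₂₉ k (FlowStep.prefixOf g k) (recordK₀ F Mc k + n))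
          (fun n => recordEmbJ F θ k (recordK₀ F Mc k + n)) (fun n => recordWrapCtr F Mc k (recordK₀ F Mc k + n))
          (fun n => recordDomEmbCtr F Mc k (recordK₀ F Mc k + n)) (fun n _ => recordCoordProjCtr F (recordK₀ F Mc k + n)) E₀ κ) →
      (∀ k n : ℕ, P9RegAt F θ k (recordK₀ F Mc k + n)) →
      (∀ k : ℕ, (∀ a : θ.ιβ, Response9DAtL F θ a Mc k (recordK₀ F Mc k) (min (1 / 4 : ℝ) (min α₁ (α₀ / 36))) C₉ δ₀) ∧
          (∀ n : ℕ, IotaRowAtL F θ k (recordK₀ F Mc k + n)) ∧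
          ∀ (n : ℕ) (a : θ.ιβ), ResponseRowAtL F θ k (recordK₀ F Mc k + n) a) →
      (∀ k : ℕ, (∀ n, B12Decay510.GeomLeaf (recordSiteGeom F Mc k (recordK₀ F Mc k + n)) (recordRho F k (recordK₀ F Mc k + n)) Mg c₁ ∧
            B12Decay510.CubeSumLeaf (recordSiteGeom F Mc k (recordK₀ F Mc k + n)) (δ₀ / 2) K₁ ∧
            B12Decay510.TreeLeaf (recordCc F Mc k (recordK₀ F Mc k + n)) (κ / 2) K₀') ∧
        ∀ (μ ν : Fin 4) (z : Fin 4 → ℤ), ∀ᶠ n in atTop,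
          recordRho F k (recordK₀ F Mc k + n) (recordE F k (recordK₀ F Mc k + n) μ 0) (recordE F k (recordK₀ F Mc k + n) ν z) = B12Sec2to5.l1 z) →
      RecordPolLimitOnRunsAx F a₀ ε₂₉ γ₀ →
      RecordPlimDecayOnRunsAx F a₀ ε₂₉ γ₀
        (16 * E₀ * C₉ ^ 2 * Real.exp (B12Decay510.delta1 δ₀ κ Mg * Mg * c₁) * K₀' * K₁) (B12Decay510.delta1 δ₀ κ Mg) := by
  intro F a₀ ε₂₉ γ₀ α₀ α₁ hα₀ hα₁ Mc h8 hP9 h7 hG h121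
  exact recordPlimDecayOnRunsAx_of_trace_L hE₀ hκ hC₉ hδ₀ hMg hK₀' F a₀ ε₂₉ γ₀ α₀ α₁ hα₀ hα₁ Mc
    (fun k n => recordEmbL F (thetaFill F a₀ ε₂₉) k (recordK₀ F Mc k + n)) h8
    (fun k n => swapRowAtL_of_p9RegAt F (thetaFill F a₀ ε₂₉) Mc (BalabanUVNodesPortS1.succ_le_m_add_K_recordK₀ F Mc k n) (hP9 k n))
    (fun k => ⟨(h7 k).1, fun n => (h7 k).2.1 n, fun n a l => funext fun i => ((h7 k).2.2 n a l i).symm⟩) hG h121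

/-! ## JOIN §16 ∕ §18 ∕ §19 (end)  THE TEXT-LEVEL JOIN OVER THE TWO SIGNED TEXTS — every intermediate row a tree theorem BY NAME -/

/-- RECEIPT (E4a) under the texts' guards: ★ PTB-1 ✓p801893 `PortU8.responseRowAtL_of_tokP9reg` at `θ := thetaFill F a₀ ε₂₉` — its `0 < θ.εbg` IS the texts' own
`0 < a₀` (`(thetaFill F a₀ ε₂₉).εbg` is `a₀` definitionally), its `C²` hypothesis is TokP9-reg's `AnalyticAt.contDiffAt` (JOIN §18 `responseRowH_holds`, re-keyed).
[cite: Balaban1985Variational, Prop. 9 p.309, (21) p.281; Balaban1987RG1, (4.35) p.290] -/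
theorem responseRowAtL_of_p9RegAt (F : T4Family) (a₀ ε₂₉ : ℝ) (ha₀ : 0 < a₀) (k K : ℕ) (hk : k + 1 ≤ (F.P K).m + (F.P K).K)
    (hP9 : P9RegAt F (thetaFill F a₀ ε₂₉) k K) :
    letI θ := thetaFill F a₀ ε₂₉; letI := θ.instιβ
    ∀ a : θ.ιβ, ResponseRowAtL F θ k K a := by
  letI := (thetaFill F a₀ ε₂₉).instVβ₁; letI := (thetaFill F a₀ ε₂₉).instVβ₂; letI := (thetaFill F a₀ ε₂₉).instιβ
  intro a
  exact PortU8.responseRowAtL_of_tokP9reg F (thetaFill F a₀ ε₂₉) k K hk ha₀ (AnalyticAt.contDiffAt hP9) a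

/-- RECEIPT (E1′) under the texts' guards: `IotaRowAtL F (thetaFill F a₀ ε₂₉) k K` from `P9RegAt` (◇ lens-1's `iotaRowAtL_of_tokP9reg`, tree file `…PortHIotaRowAtL`,
ORDER O-7; JOIN §19 `iotaRowH_holds`, re-keyed). [cite: Balaban1985Variational, Prop. 9 p.309; Balaban1987RG1, (4.35) p.290] -/
theorem iotaRowAtL_of_p9RegAt (F : T4Family) (a₀ ε₂₉ : ℝ) (ha₀ : 0 < a₀) (k K : ℕ) (hk : k + 1 ≤ (F.P K).m + (F.P K).K)
    (hP9 : P9RegAt F (thetaFill F a₀ ε₂₉) k K) : IotaRowAtL F (thetaFill F a₀ ε₂₉) k K :=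
  iotaRowAtL_of_tokP9reg F a₀ ε₂₉ ha₀ k K hk hP9

/-- ★★★★★★★ **THE JOIN OF RECORD — NO RECEIPT OWED** (lens-1 JOIN v5.2 `joinGoalL_of_texts_final`, keyed to the LOCAL verbatim texts `Sig8LR4 ∕ Sig7L9`, docket O-8): ⁸
(stmt-QuantumFields-27930 `PortRecordRepresentationS1`, SIGNED 12934e3fd231d69a, OPEN; `∀ F, Sig8LR4 F`) → ⁷‴ (stmt-QuantumFields-27931 `PortPieceLocalityU8`, SIGNED v9-L
ce176c419bf63055, OPEN; `∀ F, Sig7L9 F`) → `JoinGoalL F` for every family (2″'s antecedent shape over v9-L's hypothesis list: … → ∃ γ₀ ε₂₉ C δ₁, 0 < γ₀ ∧ 0 < ε₂₉ ∧ (RecordPolLimitOnRunsAx →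
RecordPlimDecayOnRunsAx)).  LETTERS: `γ₀ ε₂₉ E₀ κ α₀ α₁` := ⁸'s witnesses (⁸ fed ONCE through the bridge ✓p802240 `PortU8.tokP9L4_old_of_new`, CRIT-1 RULING (P)→(α));
`α₂ := min ¼ (min α₁ (α₀∕36))`; `C₉ δ₀` := ⁷‴'s witnesses at that `α₂`; `Mg := 4·Mc + 1`, `c₁ := 2`, `K₁ := (2·(1 − e^{−δ₀∕2})⁻¹)⁴`, `K₀ := B12TreeDecay.K₀ (4·2⁴) (2·4)`;
`C := 16·E₀·C₉²·e^{δ₁ Mg c₁}·K₀·K₁`, `δ₁ := delta1 δ₀ κ Mg`.  Every intermediate row is a tree theorem: the TokP9L4 bridge (★ PTB-1 ✓p802240), RowG at the names (✓p801674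
`PortHRecordRowG.rowG_slot8_at_names`), (E4a) (★ PTB-1 ✓p801893 via `responseRowAtL_of_p9RegAt`), (E1′) (◇ lens-1, `…PortHIotaRowAtL`, via `iotaRowAtL_of_p9RegAt`), the run level
`recordPlimDecayOnRunsAx_at_recordEmbL_of_trace` (this file; swap row `…PortHRecordJoinSwap`, rows `…PortHRecordJoinRows`, trace road ✓p801140 `PortH.decay510_plimOf_of_rows_trace`).
⁷‴'s (C2a)(C2b) conjuncts are not consumed.  HONEST: an implication from two OPEN statement items (taken as hypotheses — nothing of either is asserted here) to the JOIN goal;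
nothing of [I] (Thm 1, (1.19)–(1.22), (4.33)–(4.37), (5.10)) or [15] (Thm 1, Prop. 9, (190)) is discharged; K0⁷ ∕ K0ᴬ OPEN; NODE O 0∕1; COUNT 8∕28 · K 1∕4 UNMOVED; finite
`𝕋⁴_{L^K}` at fixed ε; **the Yang–Mills mass gap is NOT proved.** [cite: Balaban1987RG1, Thm 1 p.259, (0.20) p.256, (1.19)–(1.22) pp.263–264, (4.35)–(4.37) p.290, (5.10) p.293;
Balaban1985Variational, Prop. 9 p.309, (190) p.308, (21) p.281] -/
theorem joinGoalL_of_texts_final (h8 : ∀ F, Sig8LR4 F) (h7 : ∀ F, Sig7L9 F) (F : T4Family) : JoinGoalL F := by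
  have h8u : Sig8LR4 F := h8 F
  unfold Sig8LR4 at h8u
  obtain ⟨Mth, h8F⟩ := h8u
  unfold JoinGoalL
  refine ⟨Mth, ?_⟩
  intro Mc hMc j c c₀ c₁ B₃ B₃' a₀ a₁ hG0 hc hc₀ hc₁ hB₃ hB₃' ha₀ ha₁ hThm hGauge hUk hBg hP9
  have hP9old := PortU8.tokP9L4_old_of_new F Mc a₀ hP9
  obtain ⟨γ₀, ε₂₉, E₀, κ, α₀, α₁, hγ₀, hε, hE₀, hκ4, hα₀, hα₁, hFmt⟩ :=
    h8F Mc hMc j c c₀ c₁ B₃ B₃' a₀ a₁ hG0 hc hc₀ hc₁ hB₃ hB₃' ha₀ ha₁ hThm hGauge hUk hBg hP9old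
  have hα₂ : 0 < min (1 / 4 : ℝ) (min α₁ (α₀ / 36)) := lt_min (by norm_num) (lt_min hα₁ (by positivity))
  obtain ⟨C₉, δ₀, hC₉, hδ₀, h7k⟩ :=
    h7 F Mc j c c₀ c₁ B₃ B₃' a₀ a₁ hG0 hc hc₀ hc₁ hB₃ hB₃' ha₀ ha₁ hThm hGauge hUk hBg hP9 _ hα₂
  have hκ : 0 < κ := by linarith [kappa₀_std_pos]
  have hκ2 : 2 * B12TreeDecay.kappa₀ (4 * 2 ^ 4) (2 * 4) ≤ κ := by linarith [kappa₀_std_pos]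
  have hMg : 0 < 4 * (Mc : ℝ) + 1 := by positivity
  have hMg4 : 4 * (Mc : ℝ) ≤ 4 * (Mc : ℝ) + 1 := by linarith
  refine ⟨γ₀, ε₂₉, 16 * E₀ * C₉ ^ 2 * Real.exp (B12Decay510.delta1 δ₀ κ (4 * (Mc : ℝ) + 1) * (4 * (Mc : ℝ) + 1) * 2) *
      B12TreeDecay.K₀ (4 * 2 ^ 4) (2 * 4) * (2 * (1 - Real.exp (-(δ₀ / 2)))⁻¹) ^ 4,
    B12Decay510.delta1 δ₀ κ (4 * (Mc : ℝ) + 1), hγ₀, hε, fun h121 => ?_⟩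
  exact recordPlimDecayOnRunsAx_at_recordEmbL_of_trace (E₀ := E₀) (κ := κ) (C₉ := C₉) (δ₀ := δ₀) (Mg := 4 * (Mc : ℝ) + 1) (c₁ := 2)
    (K₀' := B12TreeDecay.K₀ (4 * 2 ^ 4) (2 * 4)) (K₁ := (2 * (1 - Real.exp (-(δ₀ / 2)))⁻¹) ^ 4) hE₀ hκ hC₉ hδ₀ hMg (B12TreeDecay.K₀_pos _ _).le
    F a₀ ε₂₉ γ₀ α₀ α₁ hα₀ hα₁ Mc hFmt (fun k n => hBg k n ε₂₉ hε)
    (fun k => ⟨(h7k k ε₂₉ hε).1,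
      fun n => iotaRowAtL_of_p9RegAt F a₀ ε₂₉ ha₀ k _ (BalabanUVNodesPortS1.succ_le_m_add_K_recordK₀ F Mc k n) (hBg k n ε₂₉ hε),
      fun n a => responseRowAtL_of_p9RegAt F a₀ ε₂₉ ha₀ k _ (BalabanUVNodesPortS1.succ_le_m_add_K_recordK₀ F Mc k n) (hBg k n ε₂₉ hε) a⟩)
    (fun k => PortHRecordRowG.rowG_slot8_at_names (F := F) (k := k) hG0 hMg4 hκ2 hδ₀) h121

/-- The same with lens-1's ARITY (`∀ F` inside, JOIN v5.2 :1778 shape): `(∀ F, Sig8LR4 F) → (∀ F, Sig7L9 F) → ∀ F, JoinGoalL F` — today literally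
`Theses.BalabanUVNodes.PortRecordRepresentationS1 → Theses.BalabanUVNodes.PortPieceLocalityU8 → lens-1's JoinGoalL` by `Iff.rfl` on each side (not stated here: O-8).
[cite: Balaban1987RG1, Thm 1 p.259, (1.19)–(1.22) pp.263–264, (5.10) p.293] -/
theorem joinGoalL_of_texts_final' (h8 : ∀ F, Sig8LR4 F) (h7 : ∀ F, Sig7L9 F) : ∀ F : T4Family, JoinGoalL F :=
  fun F => joinGoalL_of_texts_final h8 h7 F

end Summit.QuantumFields.YangMills.Theorems.PortHRecordJoin

end
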